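import Summits.Langlands.Langlands.Theses.RepeatedRootSocle
import Literature.NumberTheory.Automorphic.OrdinaryHigherHidaGSp4

/-!
# Birth skeleton for the crux `LimitClassicalUnrefinedR` (stmt-Langlands-18144)

Route `route-Langlands-RepeatedRootSocle`, crux decl
`Summit.Langlands.Langlands.Theses.RepeatedRootSocle.LimitClassicalUnrefinedR` (rank 2, "THE HEART:
socle classicality" — a `p`-adic limit `ρ` of automorphic representations which is irreducible,
symplectic with multiplier `ε`, Siegel weight-`2` ordinary at `p` with unramified `α, β`
(`α = β` allowed), pure and residually enormous is automorphic).  Skeleton registrar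
`planner-skel-stmt-Langlands-18144-0`, 2026-08-17 (BC3 of the route re-audit, bin HONEST).

## The line, in two named stubs

The intended proof (route header, TWO-LAYER PLAN) is the classicality theorem of
Boxer–Calegari–Gee–Pilloni [BCGP 2025, arXiv:2502.20645, §4.12 Thm. 4.12.4 (= Thm. 277)] run at the
weight-`(2,2)` point `x` of `ρ` on the ordinary higher-Hida / `𝔟`-cohomology datum (tree carrier
`Literature.NumberTheory.Automorphic.OrdinaryHigherHidaGSp4`), with BCGP's multiplicity
hypothesis (3) — the only place where "no repeated roots" enters their Thm. 1.1 — replaced by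
EXACTNESS OF THE `𝔪_x`-TORSION OF THE SEN–COUSIN SEQUENCE at `x` (what the route's child
`FibreCyclicity` is for: a cyclic faithful fibre is free of rank one over the Artinian Hecke
fibre `A = 𝕋_x/P`, so `0 → H³_x → Fil²_x → H²_x → 0` splits over `A` and stays exact on
`𝔪_x`-torsion).  Reading of the printed proof of Thm. 277 (p. 80 of the held text): the sequence
`0 → H³ → V_{ℂ_p}[(Θ−b)²] → H² → 0` is exact; hypothesis (3) is used ONLY to keep it exact on
`𝔪_f`-torsion; then `V_{ℂ_p}[𝔪_f] = D_Sen(ρ_f)^{⊕ n}` (Lemma 4.12.3 = Lemma 276, big image) and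
de Rhamness of `ρ_f` make `Θ` semisimple there, so the induced map `H²[𝔪_f] → H³[𝔪_f]`, which is
the Cousin map up to a non-zero scalar (Thm. 4.10.4 = Thm. 271), vanishes, and its kernel — the
classical forms — is everything; Arthur-packet stability / transfer to `GL₄` finish.

* `stub_limitPointRealisation` (hardest, XL; the INPUTS): under the hypotheses of the crux there
  is an ordinary higher-Hida datum `D` (intended: Boxer–Pilloni's, at the tame level of `ρ`,
  localised at `𝔪_ρ̄`, which is non-Eisenstein by `BigRes`) with BCGP's printed structures
  (`HasEichlerShimura` Thm. 4.9.7, `HasSenOperator`, `HasSenCousin` Thm. 4.10.4,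
  `CousinKernelAutomorphic` Prop. 4.10.1 (2) + Arthur / Gee–Taïbi transfer) and a weight-`(2,2)`
  point `x` such that: `ρ_x` and `ρ` have the same Frobenius characteristic polynomials at almost
  all places (this is where `Lim ρ`, `PSh ρ` and `BigRes ρ` are consumed: the eigensystem of the
  `p`-adic limit `ρ` is a characteristic-zero point of the ordinary family — NOTE that `Lim` as
  typed bounds neither the level nor the ordinarity of the approximating `ρ_m`, so this step is
  genuinely open, cf. the sibling crux `PadicLimitUnrefinedR`); `x` lies in the support of the
  degree-`2` ordinary cohomology (`H²[𝔪_x] ≠ 0`); the Sen operator is semisimple on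
  `V_{ℂ_p}[𝔪_x]` (Lemma 276 at `x` + de Rhamness of `ρ`, which holds because the route's `PSh`
  has DIAGONAL diagonal blocks, cf. BCGP p. 79–80 "equivalently the Sen operator … is
  semi-simple"); and TORSION EXACTNESS at `x`: every `x`-eigenvector of `ℂ_p ⊗ H²` lifts to an
  `x`-eigenvector of `Fil² V_{ℂ_p}` (the repeated-root content; from fibre cyclicity/freeness as
  above, or any other argument).  Existential over the interface: as for every interface-typed
  realisation statement it is not CHEAPLY interderivable with the crux (BC3 probes fail), and any
  proof of it — together with the sorry-free mechanism below — IS a proof of the crux.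
* `stub_senCousinVanishing` (M; the MECHANISM, coordinate-free Thm. 277 without hypothesis (3)):
  for ANY datum with `HasEichlerShimura`, `HasSenOperator`, `HasSenCousin`, if `Θ` is semisimple
  on `V_{ℂ_p}[𝔪_x]` and torsion exactness holds at `x` in degree `2`, then the Cousin map
  `H² → H³` kills every `x`-eigenvector: for `m ∈ H²[𝔪_x]` pick the eigen-lift `w ∈ Fil²`;
  `(Θ−b)w ∈ Fil³ ∩ V[𝔪_x]` (`HasSenOperator.sen_mem_torsionAt`) and `(Θ−b)²w = 0`, so
  `(Θ−b)w = 0` by semisimplicity (`IsSemisimple.isFinitelySemisimple` +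
  `IsFinitelySemisimple.genEigenspace_eq_eigenspace` on the restriction); hence
  `0 = gr³((Θ−b)w) = c • (1 ⊗ Cousin m)` with `c ≠ 0`, and `1 ⊗ Cousin m = 0` in `ℂ_p ⊗ H³`
  forces `Cousin m = 0` (`ℂ_p` is faithfully flat over the field `ℚ̄_p`).  A true
  statement of linear algebra over the carrier; plausibly M-sized in Lean (base change to `ℂ_p`,
  restriction of `Θ`, generalised vs. honest eigenspaces).
* `LimitClassicalUnrefinedR_of_stubs` (sorry-free assembly, hypothesis form: stub statements →
  the crux statement verbatim): realise, kill the Cousin map on `H²[𝔪_x] ≠ 0`, apply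
  `CousinKernelAutomorphic` at `x`, and transport the automorphy clause `Aut` from `ρ_x` to `ρ`
  along the a.e. equality of Frobenius polynomials (unramifiedness of `ρ` a.e. comes from `Pure ρ`);
  `LimitClassicalUnrefinedR_of : LimitClassicalUnrefinedR := LimitClassicalUnrefinedR_of_stubs stub₁ stub₂`
  concludes the crux BY NAME (skeleton-audit shape).

## Disproof used

* `Cruxes/LimitClassicalUnrefinedR/Disproof.lean` (refuter `rattack-stmt-Langlands-18144`, same day,
  landed while this skeleton was being checked): "the crux SURVIVES" — it records NO
  `_false_without_` theorem, no refuted strengthening, no tightness lemma and no Negative lemma, so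
  there is no obstruction for the stubs to honour; its findings are consistent with the skeleton:
  §1 `lim_of_pure_of_aut` (`Pure → Aut → Lim`: inside the bracket the crux is `Lim ↔ Aut`) — stub 1
  consumes `Lim` only for the intended construction of the point; §4
  `limitClassicalUnrefinedR_of_langlands` (`S → C` modulo the Perrin-Riou bridge; `Sympl`, `BigRes`,
  `Lim` are load-bearing for the PROOF, not for truth) — exactly the inputs stub 1 names; its remark
  that `Lim` bounds neither the level nor the exceptional set of the `ρ_m` is the CAVEAT recorded in
  stub 1's docstring.
* `Cruxes/LimitClassicalUnrefined/Disproof.lean` (refuter, stmt-Langlands-18087) concerns the rev-≤4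
  decl with multiplier `ε⁻¹` (vacuous: `false_of_sympl_inv_of_siegelShape`,
  `false_of_sympl_inv_of_pure`); the present crux IS its recommended repair R2
  (`LimitClassicalUnrefinedRepaired`, multiplier `ε`, `repaired_det_consistent`).  The stubs keep the
  multiplier `ε` verbatim (stub 1 quotes the crux bracket unchanged).

## Checks (registrar, 2026-08-17)

`lean check --json` rc 0, sorries exactly in `stub_limitPointRealisation`,
`stub_senCousinVanishing` (2 = 2, none elsewhere); `ledger skeleton check … --crux stmt-Langlands-18144`;
BC3 probes `stub → LimitClassicalUnrefinedR` and `stub → Langlands` (hypothesis `h : <stub sig>`, one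
example per tactic of `exact? | simpa using h | aesop`): 12/12 fail (see `Lines/birth.md`).
-/

set_option linter.dupNamespace false -- `Summit.Langlands.Langlands` is the mandated namespace (D-0017)

open scoped TensorProduct

namespace Summit.Langlands.Langlands.Cruxes.LimitClassicalUnrefinedR.Birth

open Summit.Langlands.Langlands.Theses.RepeatedRootSocle

/-- **Stub 1 — realisation of the `p`-adic limit as a weight-`(2,2)` point of a BCGP ordinary
higher-Hida datum, with the Galois-side inputs of the classicality argument at that point**
(hardest stub; consumes `Lim`, `PSh`, `BigRes`, `Pure`).  Conclusion, conjunct by conjunct: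
weight-two point; `HasEichlerShimura` (Thm. 4.9.7); `HasSenOperator`; `HasSenCousin`
(Thm. 4.10.4); `CousinKernelAutomorphic` (Prop. 4.10.1 (2), Arthur stability, Gee–Taïbi);
`ρ_x` and `ρ` have the same Frobenius characteristic polynomials a.e.; `H²[𝔪_x] ≠ 0`; `Θ`
semisimple on `V_{ℂ_p}[𝔪_x]` (Lemma 276 at `x` + de Rham); torsion exactness in degree `2` at `x`
(the repeated-root replacement of BCGP's hypothesis (3); intended via fibre cyclicity ⇒ freeness
over the Artinian Hecke fibre).  [cite: BoxerCalegariGeePilloni2025, §4.9 Thm. 4.9.7, §4.10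
Prop. 4.10.1 and Thm. 4.10.4, §4.12 Lemma 4.12.3 and Thm. 4.12.4, §7.3 Thm. 7.3.1, §7.4
Prop. 7.4.8] [cite: BoxerEtAl2021, §2.9] [cite: GeeTaibi2019] -/
theorem stub_limitPointRealisation :
    ∀ (p : ℕ) [Fact p.Prime], p ≠ 2 → ∀ (k : Type) [Field k] [CharP k p] [IsAlgClosed k] [TopologicalSpace k] [DiscreteTopology k] (red : Valued.integer (PadicAlgCl p) →+* k) (hcpt : Literature.NumberTheory.Automorphic.isCompact_glFiniteIntegralLevel 4 ℚ) (ι : PadicAlgCl p ≃+* ℂ), let R4 := Literature.NumberTheory.GaloisRepresentations.FramedGaloisRep ℚ (PadicAlgCl p) 4; let Pl := IsDedekindDomain.HeightOneSpectrum (NumberField.RingOfIntegers ℚ); ∀ (ρ : R4), let Sympl := fun r : R4 => r.IsSymplecticWithMultiplierFun (fun g => algebraMap ℚ_[p] (PadicAlgCl p) (((Literature.NumberTheory.GaloisRepresentations.GaloisRep.cyclotomicCharacter ℚ p g : ℤ_[p]ˣ) : ℤ_[p]) : ℚ_[p])); let PSh := fun (r : R4) (v : Pl) => ∃ (g : Matrix.GeneralLinearGroup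 (Fin 4) (PadicAlgCl p)) (α β : Field.absoluteGaloisGroup (v.adicCompletion ℚ) →* (PadicAlgCl p)ˣ), (∀ τ ∈ Literature.NumberTheory.GaloisRepresentations.absInertia (v.adicCompletion ℚ), α τ = 1 ∧ β τ = 1) ∧ ∀ τ, (∀ i j : Fin 4, j < i → (g⁻¹ * r.toLocal v τ * g).val i j = 0) ∧ (g⁻¹ * r.toLocal v τ * g).val 0 1 = 0 ∧ (g⁻¹ * r.toLocal v τ * g).val 2 3 = 0 ∧ (g⁻¹ * r.toLocal v τ * g).val 0 0 = algebraMap ℚ_[p] (PadicAlgCl p) (((Literature.NumberTheory.GaloisRepresentations.GaloisRep.cyclotomicCharacter (v.adicCompletion ℚ) p τ : ℤ_[p]ˣ) : ℤ_[p]) : ℚ_[p]) * α τ ∧ (g⁻¹ * r.toLocal v τ * g).val 1 1 = algebraMap ℚ_[p] (PadicAlgCl p) (((Literature.NumberTheory.GaloisRepresentations.GaloisRep.cyclotomicCharacter (v.adicCompletion ℚ) p τ : ℤ_[p]ˣ) : ℤ_[p]) : ℚ_[p]) * β τ ∧ (g⁻¹ * r.toLocal v τ * g).val 2 2 = ((β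 τ)⁻¹ : (PadicAlgCl p)ˣ) ∧ (g⁻¹ * r.toLocal v τ * g).val 3 3 = ((α τ)⁻¹ : (PadicAlgCl p)ˣ); let Pure := fun r : R4 => ∀ᶠ v : Pl in Filter.cofinite, r.IsUnramifiedAt v ∧ ∃ P : Polynomial ℤ, r.HasFrobCharpolyAt v (P.map (Int.castRingHom (PadicAlgCl p))) ∧ ∀ z : ℂ, (P.map (Int.castRingHom ℂ)).IsRoot z → ‖z‖ ^ 2 = (v.residueCard : ℝ); let BigRes := fun r : R4 => ∃ σ : Literature.NumberTheory.GaloisRepresentations.FramedGaloisRep ℚ k 4, (∀ᶠ v : Pl in Filter.cofinite, ∃ (P : Polynomial (Valued.integer (PadicAlgCl p))) (Pb : Polynomial k), r.HasFrobCharpolyAt v (P.map (Valued.integer (PadicAlgCl p)).subtype) ∧ σ.HasFrobCharpolyAt v Pb ∧ P.map red = Pb) ∧ σ.toGaloisRep.IsIrreducible ∧ ∃ x, ((σ x).val.charpoly).Separable; let Aut := fun r : R4 => ∃ π : Literature.NumberTheory.Automorphic.CuspidalAutomorphicRepData 4 ℚ hcpt, π.1.IsLAlgebraic ∧ ∀ᶠ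 v : Pl in Filter.cofinite, ∃ a : Multiset ℂ, π.1.HasSatakeParamAt v a ∧ r.IsUnramifiedAt v ∧ r.HasFrobCharpolyAt v (Literature.NumberTheory.Automorphic.arithFrobPolyOfSatake ι v.residueCard 1 a); let Lim := fun r : R4 => ∀ m : ℕ, ∃ r' : R4, Aut r' ∧ ∀ᶠ v : Pl in Filter.cofinite, ∃ P P' : Polynomial (Valued.integer (PadicAlgCl p)), r.HasFrobCharpolyAt v (P.map (Valued.integer (PadicAlgCl p)).subtype) ∧ r'.HasFrobCharpolyAt v (P'.map (Valued.integer (PadicAlgCl p)).subtype) ∧ ∀ i : ℕ, ((p : ℕ) : Valued.integer (PadicAlgCl p)) ^ m ∣ (P - P').coeff i; ρ.toGaloisRep.IsIrreducible → Sympl ρ → (∀ v : Pl, ((p : ℕ) : NumberField.RingOfIntegers ℚ) ∈ v.asIdeal → PSh ρ v) → Pure ρ → BigRes ρ → Lim ρ → ∃ (S : Set Pl) (Λ : Type) (_ : CommRing Λ) (_ : Algebra Λ (PadicAlgCl p)) (𝕋 : Type) (_ : CommRing 𝕋) (_ : Algebra Λ 𝕋) (D : Literature.NumberTheory.Automorphic.OrdinaryHigherHidaGSp4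 p S Λ 𝕋) (x : 𝕋 →+* PadicAlgCl p), D.IsWeightTwoPoint x ∧ D.HasEichlerShimura ∧ D.HasSenOperator ∧ D.HasSenCousin ∧ D.CousinKernelAutomorphic hcpt ι ∧ (∀ᶠ v : Pl in Filter.cofinite, ∀ P : Polynomial (PadicAlgCl p), (D.galoisRep x).HasFrobCharpolyAt v P ↔ ρ.HasFrobCharpolyAt v P) ∧ D.eigenspaceAt 2 x ≠ ⊥ ∧ D.IsSenSemisimpleOn (D.torsionAt x) ∧ (∀ m ∈ D.eigenspaceAt 2 x, ∃ (w : D.VC) (hw : w ∈ D.fil (2 : Fin 4)), w ∈ D.torsionAt x ∧ D.gradedToColeman 2 ⟨w, hw⟩ = (1 : PadicComplex p) ⊗ₜ[PadicAlgCl p] m) := by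
  sorry

/-- **Stub 2 — the Sen–Cousin vanishing mechanism (BCGP Thm. 4.12.4 made coordinate-free and
multiplicity-free)**: over ANY ordinary higher-Hida datum with `p`-adic Eichler–Shimura, a
Hecke-commuting filtered Sen operator and Sen = `c`·Cousin (`c ≠ 0`) in degrees `2 → 3`, if the
Sen operator is semisimple on the `x`-torsion `V_{ℂ_p}[𝔪_x]` and every `x`-eigenvector of
`ℂ_p ⊗ H²` lifts to an `x`-eigenvector of `Fil²`, then the Cousin map `H² → H³` vanishes on the
`x`-eigenspace `H²[𝔪_x]`.  Pure linear algebra over the carrier (see the module docstring for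
the five-line argument). [cite: BoxerCalegariGeePilloni2025, §4.12 Thm. 4.12.4 (proof)] -/
theorem stub_senCousinVanishing :
    ∀ (p : ℕ) [Fact p.Prime] (S : Set (IsDedekindDomain.HeightOneSpectrum (NumberField.RingOfIntegers ℚ))) (Λ : Type) [CommRing Λ] [Algebra Λ (PadicAlgCl p)] (𝕋 : Type) [CommRing 𝕋] [Algebra Λ 𝕋] (D : Literature.NumberTheory.Automorphic.OrdinaryHigherHidaGSp4 p S Λ 𝕋) (x : 𝕋 →+* PadicAlgCl p), D.HasEichlerShimura → D.HasSenOperator → D.HasSenCousin → D.IsSenSemisimpleOn (D.torsionAt x) → (∀ m ∈ D.eigenspaceAt 2 x, ∃ (w : D.VC) (hw : w ∈ D.fil (2 : Fin 4)), w ∈ D.torsionAt x ∧ D.gradedToColeman 2 ⟨w, hw⟩ = (1 : PadicComplex p) ⊗ₜ[PadicAlgCl p] m) → D.eigenspaceAt 2 x ≤ LinearMap.ker D.cousinHigh := by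
  sorry

/-- **Assembly, hypothesis form (kernel-checked, no `sorry`)**: the two stub STATEMENTS imply the
statement of the crux (conclusion = verbatim the body of
`Summit.Langlands.Langlands.Theses.RepeatedRootSocle.LimitClassicalUnrefinedR`, so that the by-name
skeleton theorem below is the unique candidate of the skeleton audit — same device as
`Cruxes/BalancedFamily/Lines/birth.lean`): realise `ρ` at the point `x`, kill the Cousin map on
`H²[𝔪_x] ≠ 0`, get the automorphy clause for `ρ_x` from `CousinKernelAutomorphic`, and transport it
to `ρ` along the a.e. equality of Frobenius characteristic polynomials (`ρ` is unramified a.e. by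
`Pure ρ`). [folklore] -/
theorem LimitClassicalUnrefinedR_of_stubs :
    (∀ (p : ℕ) [Fact p.Prime], p ≠ 2 → ∀ (k : Type) [Field k] [CharP k p] [IsAlgClosed k] [TopologicalSpace k] [DiscreteTopology k] (red : Valued.integer (PadicAlgCl p) →+* k) (hcpt : Literature.NumberTheory.Automorphic.isCompact_glFiniteIntegralLevel 4 ℚ) (ι : PadicAlgCl p ≃+* ℂ), let R4 := Literature.NumberTheory.GaloisRepresentations.FramedGaloisRep ℚ (PadicAlgCl p) 4; let Pl := IsDedekindDomain.HeightOneSpectrum (NumberField.RingOfIntegers ℚ); ∀ (ρ : R4), let Sympl := fun r : R4 => r.IsSymplecticWithMultiplierFun (fun g => algebraMap ℚ_[p] (PadicAlgCl p) (((Literature.NumberTheory.GaloisRepresentations.GaloisRep.cyclotomicCharacter ℚ p g : ℤ_[p]ˣ) : ℤ_[p]) : ℚ_[p])); let PSh := fun (r : R4) (v : Pl) => ∃ (g : Matrix.GeneralLinearGroup (Fin 4) (PadicAlgCl p)) (α β : Field.absoluteGaloisGroup (v.adicCompletion ℚ) →* (PadicAlgCl p)ˣ), (∀ τ ∈ Literature.NumberTheory.GaloisRepresentations.absInertia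 (v.adicCompletion ℚ), α τ = 1 ∧ β τ = 1) ∧ ∀ τ, (∀ i j : Fin 4, j < i → (g⁻¹ * r.toLocal v τ * g).val i j = 0) ∧ (g⁻¹ * r.toLocal v τ * g).val 0 1 = 0 ∧ (g⁻¹ * r.toLocal v τ * g).val 2 3 = 0 ∧ (g⁻¹ * r.toLocal v τ * g).val 0 0 = algebraMap ℚ_[p] (PadicAlgCl p) (((Literature.NumberTheory.GaloisRepresentations.GaloisRep.cyclotomicCharacter (v.adicCompletion ℚ) p τ : ℤ_[p]ˣ) : ℤ_[p]) : ℚ_[p]) * α τ ∧ (g⁻¹ * r.toLocal v τ * g).val 1 1 = algebraMap ℚ_[p] (PadicAlgCl p) (((Literature.NumberTheory.GaloisRepresentations.GaloisRep.cyclotomicCharacter (v.adicCompletion ℚ) p τ : ℤ_[p]ˣ) : ℤ_[p]) : ℚ_[p]) * β τ ∧ (g⁻¹ * r.toLocal v τ * g).val 2 2 = ((β τ)⁻¹ : (PadicAlgCl p)ˣ) ∧ (g⁻¹ * r.toLocal v τ * g).val 3 3 = ((α τ)⁻¹ : (PadicAlgCl p)ˣ); let Pure := fun r : R4 => ∀ᶠ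 v : Pl in Filter.cofinite, r.IsUnramifiedAt v ∧ ∃ P : Polynomial ℤ, r.HasFrobCharpolyAt v (P.map (Int.castRingHom (PadicAlgCl p))) ∧ ∀ z : ℂ, (P.map (Int.castRingHom ℂ)).IsRoot z → ‖z‖ ^ 2 = (v.residueCard : ℝ); let BigRes := fun r : R4 => ∃ σ : Literature.NumberTheory.GaloisRepresentations.FramedGaloisRep ℚ k 4, (∀ᶠ v : Pl in Filter.cofinite, ∃ (P : Polynomial (Valued.integer (PadicAlgCl p))) (Pb : Polynomial k), r.HasFrobCharpolyAt v (P.map (Valued.integer (PadicAlgCl p)).subtype) ∧ σ.HasFrobCharpolyAt v Pb ∧ P.map red = Pb) ∧ σ.toGaloisRep.IsIrreducible ∧ ∃ x, ((σ x).val.charpoly).Separable; let Aut := fun r : R4 => ∃ π : Literature.NumberTheory.Automorphic.CuspidalAutomorphicRepData 4 ℚ hcpt, π.1.IsLAlgebraic ∧ ∀ᶠ v : Pl in Filter.cofinite, ∃ a : Multiset ℂ, π.1.HasSatakeParamAt v a ∧ r.IsUnramifiedAt v ∧ r.HasFrobCharpolyAt v (Literature.NumberTheory.Automorphic.arithFrobPolyOfSatake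 ι v.residueCard 1 a); let Lim := fun r : R4 => ∀ m : ℕ, ∃ r' : R4, Aut r' ∧ ∀ᶠ v : Pl in Filter.cofinite, ∃ P P' : Polynomial (Valued.integer (PadicAlgCl p)), r.HasFrobCharpolyAt v (P.map (Valued.integer (PadicAlgCl p)).subtype) ∧ r'.HasFrobCharpolyAt v (P'.map (Valued.integer (PadicAlgCl p)).subtype) ∧ ∀ i : ℕ, ((p : ℕ) : Valued.integer (PadicAlgCl p)) ^ m ∣ (P - P').coeff i; ρ.toGaloisRep.IsIrreducible → Sympl ρ → (∀ v : Pl, ((p : ℕ) : NumberField.RingOfIntegers ℚ) ∈ v.asIdeal → PSh ρ v) → Pure ρ → BigRes ρ → Lim ρ → ∃ (S : Set Pl) (Λ : Type) (_ : CommRing Λ) (_ : Algebra Λ (PadicAlgCl p)) (𝕋 : Type) (_ : CommRing 𝕋) (_ : Algebra Λ 𝕋) (D : Literature.NumberTheory.Automorphic.OrdinaryHigherHidaGSp4 p S Λ 𝕋) (x : 𝕋 →+* PadicAlgCl p), D.IsWeightTwoPoint x ∧ D.HasEichlerShimura ∧ D.HasSenOperator ∧ D.HasSenCousin ∧ D.CousinKernelAutomorphic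 hcpt ι ∧ (∀ᶠ v : Pl in Filter.cofinite, ∀ P : Polynomial (PadicAlgCl p), (D.galoisRep x).HasFrobCharpolyAt v P ↔ ρ.HasFrobCharpolyAt v P) ∧ D.eigenspaceAt 2 x ≠ ⊥ ∧ D.IsSenSemisimpleOn (D.torsionAt x) ∧ (∀ m ∈ D.eigenspaceAt 2 x, ∃ (w : D.VC) (hw : w ∈ D.fil (2 : Fin 4)), w ∈ D.torsionAt x ∧ D.gradedToColeman 2 ⟨w, hw⟩ = (1 : PadicComplex p) ⊗ₜ[PadicAlgCl p] m)) →
    (∀ (p : ℕ) [Fact p.Prime] (S : Set (IsDedekindDomain.HeightOneSpectrum (NumberField.RingOfIntegers ℚ))) (Λ : Type) [CommRing Λ] [Algebra Λ (PadicAlgCl p)] (𝕋 : Type) [CommRing 𝕋] [Algebra Λ 𝕋] (D : Literature.NumberTheory.Automorphic.OrdinaryHigherHidaGSp4 p S Λ 𝕋) (x : 𝕋 →+* PadicAlgCl p), D.HasEichlerShimura → D.HasSenOperator → D.HasSenCousin → D.IsSenSemisimpleOn (D.torsionAt x) → (∀ m ∈ D.eigenspaceAt 2 x, ∃ (w : D.VC)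 (hw : w ∈ D.fil (2 : Fin 4)), w ∈ D.torsionAt x ∧ D.gradedToColeman 2 ⟨w, hw⟩ = (1 : PadicComplex p) ⊗ₜ[PadicAlgCl p] m) → D.eigenspaceAt 2 x ≤ LinearMap.ker D.cousinHigh) →
    ∀ (p : ℕ) [Fact p.Prime], p ≠ 2 → ∀ (k : Type) [Field k] [CharP k p] [IsAlgClosed k] [TopologicalSpace k] [DiscreteTopology k] (red : Valued.integer (PadicAlgCl p) →+* k) (hcpt : Literature.NumberTheory.Automorphic.isCompact_glFiniteIntegralLevel 4 ℚ) (ι : PadicAlgCl p ≃+* ℂ), let R4 := Literature.NumberTheory.GaloisRepresentations.FramedGaloisRep ℚ (PadicAlgCl p) 4; let Pl := IsDedekindDomain.HeightOneSpectrum (NumberField.RingOfIntegers ℚ); ∀ (ρ : R4), let Sympl := fun r : R4 => r.IsSymplecticWithMultiplierFun (fun g => algebraMap ℚ_[p] (PadicAlgCl p) (((Literature.NumberTheory.GaloisRepresentations.GaloisRep.cyclotomicCharacter ℚ p g : ℤ_[p]ˣ) : ℤ_[p]) : ℚ_[p])); let PSh := fun (r : R4) (v : Pl) => ∃ (g : Matrix.GeneralLinearGroup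 (Fin 4) (PadicAlgCl p)) (α β : Field.absoluteGaloisGroup (v.adicCompletion ℚ) →* (PadicAlgCl p)ˣ), (∀ τ ∈ Literature.NumberTheory.GaloisRepresentations.absInertia (v.adicCompletion ℚ), α τ = 1 ∧ β τ = 1) ∧ ∀ τ, (∀ i j : Fin 4, j < i → (g⁻¹ * r.toLocal v τ * g).val i j = 0) ∧ (g⁻¹ * r.toLocal v τ * g).val 0 1 = 0 ∧ (g⁻¹ * r.toLocal v τ * g).val 2 3 = 0 ∧ (g⁻¹ * r.toLocal v τ * g).val 0 0 = algebraMap ℚ_[p] (PadicAlgCl p) (((Literature.NumberTheory.GaloisRepresentations.GaloisRep.cyclotomicCharacter (v.adicCompletion ℚ) p τ : ℤ_[p]ˣ) : ℤ_[p]) : ℚ_[p]) * α τ ∧ (g⁻¹ * r.toLocal v τ * g).val 1 1 = algebraMap ℚ_[p] (PadicAlgCl p) (((Literature.NumberTheory.GaloisRepresentations.GaloisRep.cyclotomicCharacter (v.adicCompletion ℚ) p τ : ℤ_[p]ˣ) : ℤ_[p]) : ℚ_[p]) * β τ ∧ (g⁻¹ * r.toLocal v τ * g).val 2 2 = ((β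 τ)⁻¹ : (PadicAlgCl p)ˣ) ∧ (g⁻¹ * r.toLocal v τ * g).val 3 3 = ((α τ)⁻¹ : (PadicAlgCl p)ˣ); let Pure := fun r : R4 => ∀ᶠ v : Pl in Filter.cofinite, r.IsUnramifiedAt v ∧ ∃ P : Polynomial ℤ, r.HasFrobCharpolyAt v (P.map (Int.castRingHom (PadicAlgCl p))) ∧ ∀ z : ℂ, (P.map (Int.castRingHom ℂ)).IsRoot z → ‖z‖ ^ 2 = (v.residueCard : ℝ); let BigRes := fun r : R4 => ∃ σ : Literature.NumberTheory.GaloisRepresentations.FramedGaloisRep ℚ k 4, (∀ᶠ v : Pl in Filter.cofinite, ∃ (P : Polynomial (Valued.integer (PadicAlgCl p))) (Pb : Polynomial k), r.HasFrobCharpolyAt v (P.map (Valued.integer (PadicAlgCl p)).subtype) ∧ σ.HasFrobCharpolyAt v Pb ∧ P.map red = Pb) ∧ σ.toGaloisRep.IsIrreducible ∧ ∃ x, ((σ x).val.charpoly).Separable; let Aut := fun r : R4 => ∃ π : Literature.NumberTheory.Automorphic.CuspidalAutomorphicRepData 4 ℚ hcpt, π.1.IsLAlgebraic ∧ ∀ᶠ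 v : Pl in Filter.cofinite, ∃ a : Multiset ℂ, π.1.HasSatakeParamAt v a ∧ r.IsUnramifiedAt v ∧ r.HasFrobCharpolyAt v (Literature.NumberTheory.Automorphic.arithFrobPolyOfSatake ι v.residueCard 1 a); let Lim := fun r : R4 => ∀ m : ℕ, ∃ r' : R4, Aut r' ∧ ∀ᶠ v : Pl in Filter.cofinite, ∃ P P' : Polynomial (Valued.integer (PadicAlgCl p)), r.HasFrobCharpolyAt v (P.map (Valued.integer (PadicAlgCl p)).subtype) ∧ r'.HasFrobCharpolyAt v (P'.map (Valued.integer (PadicAlgCl p)).subtype) ∧ ∀ i : ℕ, ((p : ℕ) : Valued.integer (PadicAlgCl p)) ^ m ∣ (P - P').coeff i; ρ.toGaloisRep.IsIrreducible → Sympl ρ → (∀ v : Pl, ((p : ℕ) : NumberField.RingOfIntegers ℚ) ∈ v.asIdeal → PSh ρ v) → Pure ρ → BigRes ρ → Lim ρ → Aut ρ := by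
  intro hR hM p _ hp k _ _ _ _ _ red hcpt ι R4 Pl ρ Sympl PSh Pure BigRes Aut Lim hirr hsym hsh hpure
    hbig hlim
  obtain ⟨S, Λ, _, _, 𝕋, _, _, D, x, hx2, hES, hSen, hSC, hCK, hmatch, hne, hss, hlift⟩ :=
    hR p hp k red hcpt ι ρ hirr hsym hsh hpure hbig hlim
  -- the mechanism: the Cousin map kills the `x`-eigenspace of `H²`
  have hle : D.eigenspaceAt 2 x ≤ LinearMap.ker D.cousinHigh := hM p S Λ 𝕋 D x hES hSen hSC hss hlift
  have hker : D.eigenspaceAt 2 x ⊓ LinearMap.ker D.cousinHigh ≠ ⊥ := by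
    rw [inf_eq_left.mpr hle]
    exact hne
  -- classical weight-two eigenclasses in `ker (Cous)` are automorphic
  obtain ⟨π, hπalg, hπ⟩ := hCK x hx2 (Or.inr hker)
  -- `ρ` is unramified almost everywhere (first clause of purity)
  have hunr : ∀ᶠ v : IsDedekindDomain.HeightOneSpectrum (NumberField.RingOfIntegers ℚ) in Filter.cofinite,
      ρ.IsUnramifiedAt v := Filter.Eventually.mono hpure fun v hv => hv.1
  -- transport the automorphy clause from `ρ_x` to `ρ`
  refine Exists.intro π (And.intro hπalg ?_)
  filter_upwards [hπ, hmatch, hunr] with v hv hm hu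
  obtain ⟨a, ha, -, hP⟩ := hv
  exact ⟨a, ha, hu, (hm _).mp hP⟩

/-- **THE SKELETON THEOREM (registrar shape)**: the crux
`Summit.Langlands.Langlands.Theses.RepeatedRootSocle.LimitClassicalUnrefinedR` concluded BY NAME from
the two declared stubs through the sorry-free assembly `LimitClassicalUnrefinedR_of_stubs`; the only
`sorry`s in its closure are `stub_limitPointRealisation` and `stub_senCousinVanishing`. [folklore] -/
theorem LimitClassicalUnrefinedR_of : LimitClassicalUnrefinedR :=
  LimitClassicalUnrefinedR_of_stubs stub_limitPointRealisation stub_senCousinVanishing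

end Summit.Langlands.Langlands.Cruxes.LimitClassicalUnrefinedR.Birth
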